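import Mathlib
import Summits.Ventures.PercRepro2.V2SP
import Summits.Ventures.PercRepro2.Tail2DCount
import Summits.Ventures.PercRepro2.Tail2DThreePoint
import Summits.Ventures.PercRepro2.Tail2DP2Series
import Summits.Ventures.PercRepro2.Tail2DDisjointPaths
import Summits.Ventures.PercRepro2.Tail2DThirdInequality

/-!
# `P(e²) ∧ Y` keeps the M♮ class for EVERY series–parallel `Y` (seat mine-b, cell pub-perc-repro2)

The transport rule `MTailPat.par_p2ser` asks for nine inequalities between the flow-event counts of
a pattern `Y`. By the colour swap (`card_swap`) the blue statistics equal the red ones, and the nine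
hypotheses collapse to two theorems of the grammar: `#{r ≥ 2} ≤ #{r ≥ 1 ∧ b ≥ 1}`
(`disjoint_le_conn`, two disjoint red paths are rarer than a red and a blue path) and the third
inequality `n₀₀ n₁₁ ≤ n₁₀ (n₁₀ + n₂₀)` (`third_count`, through the Harris and BK′ invariants).
Hence — with the three non-degeneracy conditions (`Y` attains red flow `≥ 2`, blue flow `≥ 2`, and
both flows `≥ 1`) — parallel composition with the bundle-in-series `P(e²) ∧ Y` preserves M♮
counting tails for EVERY pattern `Y` of the grammar (`MTailPat.par_p2ser_sp`): the class 𝒴 of the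
registry contains `P(e²) ∧ Y` for all series–parallel `Y`.
-/

namespace Summit.Ventures.PercRepro2.Tail2D

open V2Closure

/-- the colour swap exchanges the two arguments of any statistic -/
lemma card_swap (Y : V2Closure.SP) (p : ℕ → ℕ → Prop) [∀ a b, Decidable (p a b)] :
    (Finset.univ.filter (fun y : Y.Conf => p (Y.bLab y) (Y.rLab y))).card
      = (Finset.univ.filter (fun y : Y.Conf => p (Y.rLab y) (Y.bLab y))).card := by
  refine Finset.card_bij' (fun y _ => swapConf Y y) (fun y _ => swapConf Y y) ?_ ?_ ?_ ?_
  · intro y hy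
    simp only [Finset.mem_filter, Finset.mem_univ, true_and] at hy ⊢
    rw [rLab_swapConf, bLab_swapConf]; exact hy
  · intro y hy
    simp only [Finset.mem_filter, Finset.mem_univ, true_and] at hy ⊢
    rw [rLab_swapConf, bLab_swapConf]; exact hy
  · intro y _; exact swapConf_swapConf Y y
  · intro y _; exact swapConf_swapConf Y y

/-- `#{b ≥ 2} = #{r ≥ 2}` -/
lemma stat_b2_eq (Y : V2Closure.SP) : stat Y (fun _ b => 2 ≤ b) = stat Y (fun r _ => 2 ≤ r) := by
  unfold stat; exact card_swap Y (fun r _ => 2 ≤ r)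

/-- `#{b = 1} = #{r = 1}` -/
lemma stat_b1_eq (Y : V2Closure.SP) : stat Y (fun _ b => b = 1) = stat Y (fun r _ => r = 1) := by
  unfold stat; exact card_swap Y (fun r _ => r = 1)

/-- `#{b = 0} = #{r = 0}` -/
lemma stat_b0_eq (Y : V2Closure.SP) : stat Y (fun _ b => b = 0) = stat Y (fun r _ => r = 0) := by
  unfold stat; exact card_swap Y (fun r _ => r = 0)

/-- `#{b ≥ 1 ∧ r = 0} = #{r ≥ 1 ∧ b = 0}` -/
lemma stat_b1r0_eq (Y : V2Closure.SP) :
    stat Y (fun r b => 1 ≤ b ∧ r = 0) = stat Y (fun r b => 1 ≤ r ∧ b = 0) := by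
  unfold stat; exact card_swap Y (fun r b => 1 ≤ r ∧ b = 0)

/-- **parallel composition with `P(e²) ∧ Y` keeps the M♮ class for every pattern `Y`** that attains
red flow `≥ 2`, blue flow `≥ 2` and both flows `≥ 1`: the nine transport hypotheses of
`MTailPat.par_p2ser` are theorems of the grammar. -/
theorem MTailPat.par_p2ser_sp {s : V2Closure.SP} {L : ℤ} (hs : MTailPat s L) (Y : V2Closure.SP)
    (h20 : ∃ y : Y.Conf, 2 ≤ Y.rLab y) (h02 : ∃ y : Y.Conf, 2 ≤ Y.bLab y)
    (h11 : ∃ y : Y.Conf, 1 ≤ Y.rLab y ∧ 1 ≤ Y.bLab y) :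
    MTailPat (.par s (p2ser Y)) (L + 2) ∧ MTailPat (.par (p2ser Y) s) (L + 2) := by
  have hI := stat_disjoint_le_conn Y
  have hIII := third_count Y
  have s1 := stat_b2_eq Y
  have s2 := stat_b1_eq Y
  have s3 := stat_b0_eq Y
  have s4 := stat_b1r0_eq Y
  set a2 := stat Y (fun r _ => 2 ≤ r) with ha2
  set c := stat Y (fun r b => 1 ≤ r ∧ 1 ≤ b) with hc
  set q := stat Y (fun r _ => r = 1) with hq
  set x := stat Y (fun r b => 1 ≤ r ∧ b = 0) with hx
  set p := stat Y (fun r _ => r = 0) with hp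
  set z := stat Y (fun r b => r = 0 ∧ b = 0) with hz
  rw [s3] at hIII
  have hI2 : a2 ≤ 2 * c := by omega
  have k1 : (p + p + 2 * z) * a2 ≤ (p + p + 2 * z) * (2 * c) := Nat.mul_le_mul_left _ hI2
  have k2 : (q + 2 * x) * a2 ≤ (q + 2 * x) * (2 * c) := Nat.mul_le_mul_left _ hI2
  have k3 : a2 * (q + 2 * x) ≤ (q + 2 * x) * (2 * c) := by rw [mul_comm]; exact k2
  refine MTailPat.par_p2ser hs Y h20 h02 h11 ?_ ?_ ?_ ?_ ?_ ?_ ?_ ?_ ?_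
  · -- R2
    rw [s3]; exact le_trans k1 hIII
  · -- C2
    rw [s1, s2, s3, s4]; exact le_trans k1 hIII
  · -- S
    rw [s1]; exact Nat.mul_le_mul hI2 hI2
  · -- E
    rw [s2, s4]; exact k3
  · -- E'
    rw [s1, s2, s4]; exact k3
  · -- R1
    rw [s3]; exact le_trans k1 (le_trans hIII (Nat.add_le_add_left k2 _))
  · -- C1
    rw [s1, s2, s3, s4]; exact le_trans k1 (le_trans hIII (Nat.add_le_add_left k2 _))
  · -- Λa
    rw [s2, s3, s4]; exact hIII
  · -- Λb
    rw [s1, s2, s3, s4]; exact hIII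

end Summit.Ventures.PercRepro2.Tail2D
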